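import Literature.Barriers.QuantumAdvantage.PPolyOraclesThm76Sig
import Literature.Computability.Cryptography.MaskedPRP
import Literature.Computability.Cryptography.MaskedLevels
import Literature.Computability.Cryptography.ZhandryOracleBPPMachine
import Literature.Computability.Cryptography.MaskedLevelsPPoly
import HarnessLib

/-!
# Aaronson–Chen 2017, Thm. 7.6 from a secure PRP along the Servedio–Gortler / Simon variant: the instantiation

Sibling of `PPolyOraclesThm76Sig.lean` (the construction-agnostic diagonalization
`pPolyOracleSeparation_of_sig`) instantiating it with the MASKED contents of
`Literature/Computability/Cryptography/MaskedLevels.lean`: a level carries `PRP^raw_k`,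
`PRP^raw_k ∘ rep_{1·t}` (two-to-one with the hidden XOR mask `1·t`) or the filler. [AaronsonChen2017]
(§1, pp. 9 and 11) credit the construction of Thm. 7.6 to "Zhandry and (independently) Servedio and
Gortler"; Servedio–Gortler 2004, §8.1 use exactly "a permutation or … invariant under XOR mask", told
apart by Simon's algorithm (§6) and classically indistinguishable (pseudorandomness).

**What is proved here.**

* `sigStage_mask` — the stage lemma for the masked contents, from the PROVED classical leg
  `maskedPRP_eventually_le` (`MaskedPRP.lean`: PRP security, the switching lemma, the XOR-mask lemma
  and the PPT mask adversary) and the PPT simulation leaf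
  `Literature.Computability.Cryptography.aaronsonChen2017_thm76_bppMachine` (shared with the Zhandry
  instantiation): if no content defeated `(M, q, p)` at a large level, the compiled adversary would
  accept `PRP^raw_k` with probability `≥ 2/3` on average and `PRP^raw_k ∘ rep_s` with probability
  `≤ 1/3` on average, against `|prfRealProb − maskRealProb| ≤ 1/6`.
* `sigQuantum_mask` — the quantum side from the Simon leaf
  `Literature.Computability.Cryptography.SimonLevelMachine` (a hypothesis; permutation levels are
  injective; a masked level is two-to-one with the nonzero mask `1·t`, `masked_two_to_one`).
* `aaronsonChen2017_thm76_of_prp_of_simon_leaves` — the leaf `aaronsonChen2017_thm76_of_prp` from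
  the Simon leaf, the simulation leaf, and the `P/poly` bound for masked oracles (taken as a
  hypothesis `MaskPPoly`, to be proved in a sibling by the advice machine of `PPolyOraclesPPoly.lean`
  adapted to this encoding); `aaronsonChen2017_thm76_of_prp_of_simon` — with the simulation leaf
  discharged (`aaronsonChen2017_thm76_bppMachine_holds`), two hypotheses remain;
  `aaronsonChen2017_thm76_of_prp_of_simonMachine` — with `maskOracle_mem_PPoly`
  (`MaskedLevelsPPoly.lean`) only Simon's machine remains.

## Sources

* [AaronsonChen2017] arXiv:1612.05903: §1 (pp. 9, 11), Thm. 7.6 and its proof (p. 30).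
* [ServedioGortler2004] SIAM J. Comput. 33 (2004): §6 (p. 14), Thm. 6.1, §8.1–8.3 (pp. 16–17).
-/

noncomputable section

namespace Literature.Barriers.QuantumAdvantage

open _root_.Computability Literature.Computability.Complexity Literature.Computability.Cryptography
open Finset

variable {F : FunctionEnsemble} {κ ℓ : ℕ → ℕ}

/-! ### The masked contents as a content signature -/

variable (F κ ℓ) in
/-- **The Servedio–Gortler contents as a content signature**: `Γ = MaskContent`.
[cite: ServedioGortler2004, §8.1] -/
def maskSig : ContentSig where
  Γ := MaskContent
  filler := MaskContent.filler
  isPerm := MaskContent.isPerm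
  blockLen n c := c.blockLen ℓ n
  fn n c := c.fn F n
  WellFormed n c := c.WellFormed κ ℓ n
  blockLen_filler _ := rfl
  fn_filler _ := rfl
  wellFormed_filler _ := trivial

/-- The oracle of the mask signature is `maskOracle` (definitional). [folklore] -/
theorem maskSig_oracle (C : ℕ → MaskContent) : (maskSig F κ ℓ).oracle C = maskOracle F ℓ C :=
  rfl

/-- **The `P/poly` bound for masked oracles** (the hypothesis of the assembly, to be proved by the
advice machine of the encoding): oracles of well-formed masked content assignments are in `P/poly`.
[cite: AaronsonChen2017, Thm. 7.6 (proof, p. 30: "each `f_n` has a polynomial-size circuit")] -/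
def MaskPPoly (F : FunctionEnsemble) (κ ℓ : ℕ → ℕ) : Prop :=
  ∀ C : ℕ → MaskContent, (∀ n, (C n).WellFormed κ ℓ n) → maskOracle F ℓ C ∈ PPoly

/-! ### The stage lemma for the masked contents -/

/-- A mask of `{0,1}^a` with head bit `1` reads as `1 · tail`. [folklore] -/
theorem toList_eq_cons_tail_of_mem_maskSet {a : ℕ} {s : List.Vector Bool a} (hs : s ∈ maskSet a) :
    s.toList = true :: s.toList.tail ∧ s.toList.tail.length + 1 = a := by
  have h := mem_maskSet.1 hs
  obtain ⟨l, hl⟩ := s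
  rcases l with _ | ⟨b, l⟩
  · simp at h
  · simp only [List.Vector.toList_mk, List.head?_cons, Option.some.injEq] at h
    subst h
    simp only [List.Vector.toList_mk, List.tail_cons, true_and]
    simpa using hl

/-- **The stage lemma for the masked contents** ("no `BPP` machine can distinguish" the permutation
levels from the masked levels): for a secure `PRP^raw = (F, κ, ℓ)` with `n ≤ ℓ n ≤ B n`, a
polynomial-time `M` with bounds `q, p` and finite data `(E, T)`, from some level on every level `n ∉ E`
carries a defeating content. Proof: the compiled PPT adversary `𝒜` of
`aaronsonChen2017_thm76_bppMachine` has `prfRealProb = 2^{-κ n} ∑_k accAt(prp k)` and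
`maskRealProb = (2^{κ n} |masks|)^{-1} ∑_{k,s} accAt(masked k (tail s))`; if no content defeated
`(M, q, p)` the first average would be `≥ 2/3` and the second `≤ 1/3`, against
`maskedPRP_eventually_le` with `δ = 1/6`. [cite: AaronsonChen2017, Thm. 7.6 (proof, p. 30)] [cite: ServedioGortler2004, §8.3] -/
theorem exists_defeating_maskContent (h₃ : aaronsonChen2017_thm76_bppMachine) (hF : IsPRP F κ ℓ)
    (hℓ : ∀ n, n ≤ ℓ n) {B : Polynomial ℕ} (hB : ∀ n, ℓ n ≤ B.eval n) {M : OracleAlg Bool}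
    (hM : M.IsPolyTime encodingBoolBool) (q p : Polynomial ℕ) (E : Finset ℕ) (T : Finset (List Bool)) :
    ∃ n₁ : ℕ, ∀ n, n₁ ≤ n → n ∉ E → ∃ c : MaskContent, (maskSig F κ ℓ).Defeats E T M q p n c := by
  classical
  obtain ⟨𝒜, h𝒜, hsim⟩ := h₃ M hM q p B E T
  obtain ⟨n₀, hn₀⟩ := maskedPRP_eventually_le hF hℓ h𝒜 (δ := 1 / 6) (by norm_num)
  refine ⟨max n₀ 1, fun n hn hnE => ?_⟩
  have hn₀' : n₀ ≤ n := (le_max_left _ _).trans hn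
  have hn1 : 1 ≤ n := (le_max_right _ _).trans hn
  have hℓ1 : 1 ≤ ℓ n := hn1.trans (hℓ n)
  have hEff : IsEfficientFamily F κ ℓ ℓ := hF.isEfficientFamily
  -- the simulation identity at level `n`, block length `ℓ n`
  have hsim' : ∀ f : List Bool → List Bool, (∀ y : List Bool, y.length = ℓ n → (f y).length = ℓ n) →
      𝒜.acceptProb (oracleOfFnAt (ℓ n) f) n = accAt M q p (specLang E T n (ℓ n) f) n := by
    intro f hf
    rw [accAt_eq_run]
    exact hsim n (ℓ n) f hnE hℓ1 (hB n) hf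
  have hmasks := maskSet_nonempty hℓ1
  by_contra H
  push Not at H
  -- every `prp k` is accepted with probability `≥ 2/3`
  have hprp : ∀ k : List.Vector Bool (κ n),
      2 / 3 ≤ 𝒜.acceptProb (oracleOfFnAt (ℓ n) (F n k.toList)) n := by
    intro k
    have hk : k.toList.length = κ n := k.toList_length
    rw [hsim' (F n k.toList) (fun y hy => hEff.2.2 n k.toList y hk hy)]
    by_contra hlt
    push Not at hlt
    refine H (MaskContent.prp k.toList) ⟨(MaskContent.wellFormed_prp_iff κ ℓ n _).2 hk,
      fun _ => ?_, fun h => ?_⟩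
    · simpa [maskSig] using hlt
    · simp [maskSig] at h
  -- every `masked k (tail s)` is accepted with probability `≤ 1/3`
  have hmask : ∀ (k : List.Vector Bool (κ n)) (s : List.Vector Bool (ℓ n)), s ∈ maskSet (ℓ n) →
      𝒜.acceptProb (oracleOfFnAt (ℓ n) (F n k.toList ∘ repStr s.toList)) n ≤ 1 / 3 := by
    intro k s hs
    have hk : k.toList.length = κ n := k.toList_length
    obtain ⟨hcons, htail⟩ := toList_eq_cons_tail_of_mem_maskSet hs
    rw [hsim' (F n k.toList ∘ repStr s.toList) (fun y hy => by
      rw [Function.comp_apply]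
      exact hEff.2.2 n k.toList _ hk (by rw [length_repStr, hy]))]
    by_contra hlt
    push Not at hlt
    refine H (MaskContent.masked k.toList s.toList.tail)
      ⟨(MaskContent.wellFormed_masked_iff κ ℓ n _ _).2 ⟨hk, htail⟩, fun h => ?_, fun _ => ?_⟩
    · simp [maskSig] at h
    · rw [hcons] at hlt
      simpa [maskSig] using hlt
  -- hence the two games differ by at least `1/3`
  have hreal : 2 / 3 ≤ prfRealProb F κ ℓ 𝒜 n := by
    rw [prfRealProb_eq_sum, le_div_iff₀ (by positivity)]
    have h := Finset.card_nsmul_le_sum Finset.univ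
      (fun k : List.Vector Bool (κ n) => 𝒜.acceptProb (oracleOfFnAt (ℓ n) (F n k.toList)) n) (2 / 3)
      (fun k _ => hprp k)
    rw [nsmul_eq_mul, Finset.card_univ, card_vector, Fintype.card_bool] at h
    push_cast at h
    linarith [h]
  have hmaskp : maskRealProb F κ ℓ 𝒜 n ≤ 1 / 3 := by
    unfold maskRealProb
    have hden : (0 : ℝ) < 2 ^ κ n * ((maskSet (ℓ n)).card : ℝ) := by
      have : (0 : ℝ) < (maskSet (ℓ n)).card := by exact_mod_cast hmasks.card_pos
      positivity
    rw [div_le_iff₀ hden]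
    calc ∑ k : List.Vector Bool (κ n), ∑ s ∈ maskSet (ℓ n),
          𝒜.acceptProb (oracleOfFnAt (ℓ n) (F n k.toList ∘ repStr s.toList)) n
        ≤ ∑ _k : List.Vector Bool (κ n), ∑ _s ∈ maskSet (ℓ n), (1 / 3 : ℝ) :=
          Finset.sum_le_sum fun k _ => Finset.sum_le_sum fun s hs => hmask k s hs
      _ = 1 / 3 * (2 ^ κ n * ((maskSet (ℓ n)).card : ℝ)) := by
          simp only [Finset.sum_const, Finset.card_univ, card_vector, Fintype.card_bool, nsmul_eq_mul]
          push_cast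
          ring
  have hgap := hn₀ n hn₀'
  rw [abs_le] at hgap
  linarith [hgap.1, hgap.2]

/-- **`SigStage` for the masked contents.** [cite: AaronsonChen2017, Thm. 7.6 (proof, p. 30)] -/
theorem sigStage_mask (h₃ : aaronsonChen2017_thm76_bppMachine) (hF : IsPRP F κ ℓ) (hℓ : ∀ n, n ≤ ℓ n) :
    (maskSig F κ ℓ).SigStage := by
  obtain ⟨qB, hqB⟩ := hF.isEfficientFamily.2.1
  intro M hM q p E T
  exact exists_defeating_maskContent h₃ hF hℓ (B := qB) (fun n => (hqB n).2.1) hM q p E T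

/-! ### The quantum side from the Simon leaf -/

/-- **A masked level is two-to-one with its mask**: for `g` injective on `{0,1}^j` and a mask
`s = 1·t` of length `j`, `g (rep_s y) = g (rep_s y') ↔ y' ∈ {y, y ⊕ s}` on `{0,1}^j`.
[cite: ServedioGortler2004, §6 (Case 2)] -/
theorem masked_two_to_one {g : List Bool → List Bool} {j : ℕ} (hg : Set.InjOn g {y : List Bool | y.length = j})
    {t : List Bool} (ht : t.length + 1 = j) {y y' : List Bool} (hy : y.length = j) (hy' : y'.length = j) :
    g (repStr (true :: t) y) = g (repStr (true :: t) y') ↔ y' = y ∨ y' = xorStr y (true :: t) := by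
  have hs : (true :: t).length = j := by simpa using ht
  constructor
  · intro h
    have hrep : repStr (true :: t) y = repStr (true :: t) y' :=
      hg (by simp [hy]) (by simp [hy']) h
    rcases eq_or_eq_xor_of_repStr_eq (hy'.trans hs.symm) (hy.trans hs.symm) hrep.symm with h1 | h1
    · exact Or.inl h1
    · exact Or.inr h1
  · rintro (rfl | rfl)
    · rfl
    · rw [repStr_xorStr rfl (hy.trans hs.symm)]

/-- **`SigQuantum` for the masked contents** from the Simon leaf (probe bound `B = q_F + X ≥ ℓ n, n`):
a well-formed permutation level is the identity of `{0,1}ⁿ` or `PRP^raw_k`, injective on its block,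
so clause (i) applies; a well-formed masked level `PRP^raw_k ∘ rep_{1·t}` is two-to-one with the
nonzero mask `1·t`, so clause (ii) applies. [cite: ServedioGortler2004, §8.2 (Thm. 8.1)] -/
theorem sigQuantum_mask (hQ : ∀ B : Polynomial ℕ, SimonLevelMachine B) (hF : IsPRP F κ ℓ) (hℓ : ∀ n, n ≤ ℓ n) :
    (maskSig F κ ℓ).SigQuantum := by
  have hEff : IsEfficientFamily F κ ℓ ℓ := hF.isEfficientFamily
  obtain ⟨qB, hqB⟩ := hEff.2.1
  set B : Polynomial ℕ := qB + Polynomial.X with hBdef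
  have hB : ∀ n, ℓ n ≤ B.eval n := fun n => by
    have := (hqB n).2.1
    simp only [hBdef, Polynomial.eval_add, Polynomial.eval_X]; omega
  have hBn : ∀ n, n ≤ B.eval n := fun n => by
    simp only [hBdef, Polynomial.eval_add, Polynomial.eval_X]; omega
  obtain ⟨N₁, hN₁⟩ := hQ B
  refine ⟨N₁, fun n₀ hn₀ => ?_⟩
  obtain ⟨D, hDu, hDlow, hD⟩ := hN₁ n₀ hn₀
  refine ⟨D, hDu, hDlow, fun O x hxn c hwf hagree => ?_⟩
  rcases c with _ | k | ⟨k, t⟩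
  · -- filler
    refine ⟨fun _ => ?_, fun h => by simp [maskSig] at h⟩
    exact (hD O x hxn x.length id le_rfl (hBn _) (fun y hy => hy) hagree).1 (Set.injOn_id _)
  · -- `PRP^raw_k`
    have hk : k.length = κ x.length := hwf
    refine ⟨fun _ => ?_, fun h => by simp [maskSig] at h⟩
    exact (hD O x hxn (ℓ x.length) (F x.length k) (hℓ _) (hB _)
      (fun y hy => hEff.2.2 x.length k y hk hy) hagree).1 (hF.injOn x.length hk)
  · -- `PRP^raw_k ∘ rep_{1·t}`
    have hk : k.length = κ x.length ∧ t.length + 1 = ℓ x.length := hwf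
    refine ⟨fun h => by simp [maskSig] at h, fun _ => ?_⟩
    refine (hD O x hxn (ℓ x.length) (F x.length k ∘ repStr (true :: t)) (hℓ _) (hB _)
      (fun y hy => by
        rw [Function.comp_apply]
        exact hEff.2.2 x.length k _ hk.1 (by rw [length_repStr, hy])) hagree).2
      ⟨true :: t, by simpa using hk.2, rfl, fun y y' hy hy' => ?_⟩
    exact masked_two_to_one (hF.injOn x.length hk.1) hk.2 hy hy'

/-! ### Assembly along the Simon variant -/

/-- **Aaronson–Chen 2017, Thm. 7.6 from a secure PRP, along the Servedio–Gortler / Simon variant.**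
Given the Simon machine (`SimonLevelMachine`, hypothesis), the PPT simulation leaf
(`aaronsonChen2017_thm76_bppMachine`) and the `P/poly` bound for masked oracles, every secure
pseudorandom permutation with block length `ℓ n ≥ n` yields an oracle language `O ∈ P/poly` with
`BPP^O ≠ BQP^O` — the classical leg being PROVED (`maskedPRP_eventually_le`).
[cite: AaronsonChen2017, Thm. 7.6 (p. 30) and §1 (p. 9)] [cite: ServedioGortler2004, Thm. 1.3 (§8)] -/
theorem aaronsonChen2017_thm76_of_prp_of_simon_leaves (hQ : ∀ B : Polynomial ℕ, SimonLevelMachine B)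
    (h₃ : aaronsonChen2017_thm76_bppMachine)
    (hP : ∀ (F : FunctionEnsemble) (κ ℓ : ℕ → ℕ), IsEfficientFamily F κ ℓ ℓ → MaskPPoly F κ ℓ) :
    aaronsonChen2017_thm76_of_prp := by
  rintro ⟨F, κ, ℓ, hF, hℓ⟩
  exact pPolyOracleSeparation_of_sig (maskSig F κ ℓ) (sigQuantum_mask hQ hF hℓ)
    (sigStage_mask h₃ hF hℓ) (fun C hC => hP F κ ℓ hF.isEfficientFamily C hC)

/-- **The same with the simulation leaf discharged** (`aaronsonChen2017_thm76_bppMachine_holds`,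
`ZhandryOracleBPPMachine.lean`): along the Simon variant the leaf `aaronsonChen2017_thm76_of_prp`
now rests on exactly two hypotheses — Simon's machine for the level encoding and the `P/poly`
bound for masked oracles. [cite: AaronsonChen2017, Thm. 7.6 (p. 30)] -/
theorem aaronsonChen2017_thm76_of_prp_of_simon (hQ : ∀ B : Polynomial ℕ, SimonLevelMachine B)
    (hP : ∀ (F : FunctionEnsemble) (κ ℓ : ℕ → ℕ), IsEfficientFamily F κ ℓ ℓ → MaskPPoly F κ ℓ) :
    aaronsonChen2017_thm76_of_prp :=
  aaronsonChen2017_thm76_of_prp_of_simon_leaves hQ aaronsonChen2017_thm76_bppMachine_holds hP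

/-- **Along the Simon variant, Thm. 7.6 from a secure PRP rests on Simon's machine alone**: with the
`P/poly` bound for masked oracles discharged as well (`maskOracle_mem_PPoly`,
`MaskedLevelsPPoly.lean`, by reduction to `aaronsonChen2017_thm76_memPPoly_holds`), the leaf
`aaronsonChen2017_thm76_of_prp` (`PRPExist → PPolyOracleSeparation`) follows from the single
hypothesis `∀ B, SimonLevelMachine B` — Simon's algorithm as a uniform `BQP^O` machine for the
level encoding (Servedio–Gortler 2004, §6). Everything classical in Aaronson–Chen's proof of
Thm. 7.6 along this variant (PRP/PRF switching, the XOR-mask hybrid, the PPT mask adversary, the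
`BPP^O` simulation, the Ko-stage diagonalization, `O ∈ P/poly`) is proved in the tree.
[cite: AaronsonChen2017, Thm. 7.6 (p. 30)] [cite: ServedioGortler2004, §6 and Thm. 1.3] -/
theorem aaronsonChen2017_thm76_of_prp_of_simonMachine (hQ : ∀ B : Polynomial ℕ, SimonLevelMachine B) :
    aaronsonChen2017_thm76_of_prp :=
  aaronsonChen2017_thm76_of_prp_of_simon hQ fun _ _ _ hF _ hC => maskOracle_mem_PPoly hF hC

end Literature.Barriers.QuantumAdvantage

end
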